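import Summits.AnomalousDissipation.AnomalousDissipation.Theorems.SawtoothPulseCascadeK2InjectionHarmonic
import Mathlib.Analysis.SpecialFunctions.Sqrt

/-!
# K2″ injection phase: the perpendicular-slot harmonic estimate REDUCED TO A CROSS-STREAM BOUND
(route `AnomalousDissipation/SawtoothPulseCascade`, crux K2″ = stmt-AnomalousDissipation-19696
`K2LinearisedCascadeGrowth`, line `phase-cocycle` (skeleton 0c87d78a), stub A `stub_injectionPhase`; helper,
`--supports`; sequel of `…K2InjectionHarmonic`)

After `injectionPhase_of_harmonics` (p793897) the open content of stub A is ONE estimate: on the V half-slot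
`[a, b] = [tStart j₀ + tHalf j₀, tStart (j₀+1)]`, every classical linearised response `W` launched from a single
streamwise harmonic `Re (e_{l e₁} z)` (`z₁ = 0`: a purely CROSS-STREAM velocity for the vertical pulse
`(0, rateV j₀ t · U_{j₀}(x₀))`) has energy amplified by at most `(3e^{σ⋆γ})² ∈ [321, 1277]` for `γ ∈ (5.77, 8]`;
the energy method gives only `e^{γ}` (`vectorL2Sq_le_exp_of_mem_V`).  This file proves the **lift-up / Orr
algebraic-growth form of the energy method**: the production of a shear is `2|∫ c w_k w_m| ≤ 2r‖w_k‖‖w_m‖`, so a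
bound `‖w_k(s)‖_{L²} ≤ M` on the CROSS-STREAM component alone gives `d/dt ∫‖w‖² ≤ 2rM(∫‖w‖²)^{1/2}`, i.e.
`∫‖w(t)‖² ≤ ((∫‖w(a)‖²)^{1/2} + M∫ₐᵗ r)²` — quadratic in the strain (Ellingsen–Palm's algebraic growth, in energy
form, along a time-dependent shear):
* §1 `two_mul_abs_inner_convect_le_of_shear_weighted` — `2|⟪(w·∇)u, w⟫| ≤ |c|(λw_k² + ‖w‖²/λ)`, every `λ > 0`;
* §2 `linearisedNS_integral_norm_sq_le_sq_of_shear_of_crossStream` — the bound above on `[a, b] × 𝕋^d`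
  (energy identity, weight `λ = (E+ε)^{1/2}/(M+ε)`, `Literature.Analysis.ODE.le_of_deriv_right_nonpos`, `ε → 0`);
* §3 `crossStream_energy_le_of_mem_V(')` — on a V half-slot of the cascade: `≤ ((∫‖w(a)‖²)^{1/2} + Mγ)²`, and
  with `M = C₀(∫‖w(a)‖²)^{1/2}`: amplification `≤ (1 + C₀γ)²`;
* §4 `one_add_two_mul_le_three_mul_exp` (`1 + 2γ ≤ 3e^{σ⋆γ}`, all `γ ≥ 0`) and `injectionPhase_of_crossStream` —
  **the registered stub A VERBATIM** from the cross-stream bound `∫ (W(t) x)₀² ≤ 2²‖W(a)‖²` on the V slot for the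
  single-harmonic responses of `injectionPhase_of_harmonics`, `γ ∈ (5.77, 8]`.
So the open content of `stub_injectionPhase` is now a bound on the Orr–Sommerfeld variable alone: the cross-stream
velocity of ONE modally neutral streamwise harmonic (`l/N_{j₀} ∈ {1,3,5,…}`) of the rounded, viscous, finite-time
V pulse is amplified in `L²` by at most `2` (any `C₀` with `(1 + C₀γ)² ≤ 9e^{2σ⋆γ}` on `(5.77, 8]`, e.g. `C₀ ≤ 2.9`,
would do by §3), uniformly in `j₀` and `ν ≤ ν₀`.  Nothing here claims that bound.
-/

-- `Summit.<Summit>.<Problem>` is the tree's mandated summit-side namespace (CONVENTIONS §2); for this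
-- single-conjunct summit the two coincide, so the duplicate is deliberate (lakefile: off for `Summits`).
set_option linter.dupNamespace false

noncomputable section

namespace Summit.AnomalousDissipation.AnomalousDissipation.Theorems.SawtoothPulseCascade.K2Classical

open Set MeasureTheory Filter
open scoped InnerProductSpace ContDiff Topology
open Literature.Analysis Literature.Analysis.FunctionSpaces Literature.Analysis.FluidPDE
open Literature.Analysis.FluidPDE.SawtoothCascade
open Literature.Analysis.FluidPDE.SawtoothCascade.CascadeParams

/-! ## §1 The production term of a shear, weighted form -/

section Shear

variable {d : Type*} [Fintype d] [DecidableEq d]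

/-- **Weighted pointwise production bound for a shear.** Let `v : 𝕋^d → ℝ^d` be smooth and, at the point
`x`, depend only on the `k`-th coordinate to first order (`∂ᵢv(x) = 0` for `i ≠ k`) with `∂ₖv(x) = c · eₘ`
along a fixed axis `m` (for a divergence-free shear `m ≠ k`, not needed here). Then
`⟪(w·∇)v, w⟫(x) = c wₖ(x) wₘ(x)` and, for every weight `λ > 0`,
`2|⟪(w·∇)v, w⟫(x)| ≤ |c| (λ wₖ(x)² + ‖w(x)‖²/λ)` (AM–GM `2|wₖ||wₘ| ≤ λwₖ² + wₘ²/λ`, `wₘ² ≤ ‖w‖²).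
[cite: MajdaBertozziCUP2002, §3.1.1 Prop. 3.1 (energy estimate: the stretching term ⟪(w·∇)v, w⟫)] -/
theorem two_mul_abs_inner_convect_le_of_shear_weighted {v w : UnitAddTorus d → EuclideanSpace ℝ d}
    (hv : Torus.IsSmooth v) {k m : d} {x : UnitAddTorus d} {c : ℝ}
    (h0 : ∀ i, i ≠ k → Torus.partialDeriv i v x = 0)
    (hk : Torus.partialDeriv k v x = c • EuclideanSpace.single m (1 : ℝ)) {l : ℝ} (hl : 0 < l) :
    2 * |⟪Torus.convect w v x, w x⟫_ℝ| ≤ |c| * (l * (w x k) ^ 2 + ‖w x‖ ^ 2 / l) := by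
  have hconv : Torus.convect w v x = ∑ i, w x i • Torus.partialDeriv i v x :=
    Torus.fderiv_apply_eq_sum_partialDeriv (hv.isContDiff (by simp)) x (w x)
  rw [Finset.sum_eq_single k (fun i _ hik => by rw [h0 i hik, smul_zero])
    (fun h => absurd (Finset.mem_univ k) h)] at hconv
  rw [hconv, hk, real_inner_smul_left, real_inner_smul_left, EuclideanSpace.inner_single_left]
  simp only [map_one, one_mul]
  have hsq : (w x m) ^ 2 ≤ ‖w x‖ ^ 2 := by
    rw [EuclideanSpace.norm_sq_eq]
    calc (w x m) ^ 2 = ∑ i ∈ ({m} : Finset d), ‖w x i‖ ^ 2 := by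
          rw [Finset.sum_singleton, Real.norm_eq_abs, sq_abs]
      _ ≤ ∑ i, ‖w x i‖ ^ 2 :=
          Finset.sum_le_sum_of_subset_of_nonneg (Finset.subset_univ _) fun i _ _ => sq_nonneg _
  rw [abs_mul, abs_mul]
  have h2 : 2 * (|w x k| * |w x m|) ≤ l * (w x k) ^ 2 + (w x m) ^ 2 / l := by
    have e1 : l * (w x k) ^ 2 + (w x m) ^ 2 / l = ((l * w x k) ^ 2 + (w x m) ^ 2) / l := by
      field_simp
    rw [e1, le_div_iff₀ hl, mul_pow]
    have h3 : 2 * (|w x k| * |w x m|) * l ≤ (l * |w x k|) ^ 2 + |w x m| ^ 2 := by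
      nlinarith [sq_nonneg (l * |w x k| - |w x m|)]
    rw [mul_pow, sq_abs, sq_abs] at h3
    exact h3
  calc 2 * (|w x k| * (|c| * |w x m|)) = |c| * (2 * (|w x k| * |w x m|)) := by ring
    _ ≤ |c| * (l * (w x k) ^ 2 + (w x m) ^ 2 / l) := by gcongr
    _ ≤ |c| * (l * (w x k) ^ 2 + ‖w x‖ ^ 2 / l) := by gcongr

end Shear

/-! ## §2 Algebraic (lift-up) energy growth along a shear under a cross-stream bound -/

section Energy

variable {d : Type*} [Fintype d] [DecidableEq d]
variable {a b ν : ℝ} {u w : ℝ → UnitAddTorus d → EuclideanSpace ℝ d} {q : ℝ → UnitAddTorus d → ℝ}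

/-- **Algebraic energy growth for the linearised Navier–Stokes equation along a shear, given a bound on the
cross-stream component.** `u` jointly smooth, divergence free on `[a, b] × 𝕋^d`, a shear (`∂ᵢu = 0` for
`i ≠ k`, `∂ₖu = c eₘ`, `|c(t, x)| ≤ r(t)`, `r` continuous); `(w, q)` a smooth solution of
`∂ₜw + (u·∇)w + (w·∇)u = νΔw − ∇q`, `div w = 0` (`ν ≥ 0`) with `∫ wₖ(s)² ≤ M²` on `[a, b]` (`M ≥ 0`).  Then
`∫ ‖w(t)‖² ≤ ((∫ ‖w(a)‖²)^{1/2} + M ∫ₐᵗ r)²` on `[a, b]` (production `≤ 2rM(∫‖w‖²)^{1/2}`, so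
`((∫‖w‖² + ε)^{1/2})′ ≤ r(M + ε)`; `ε → 0`) — Ellingsen–Palm's algebraic growth of streaks driven by a bounded
cross-stream velocity, in energy form, versus `exp(∫ₐᵗ r)` of `…le_mul_exp_integral_of_shear`.
[cite: EllingsenPalm1975, eq. (5)–(7) (u grows linearly in t when v is time independent); MajdaBertozziCUP2002, §3.1.1 Prop. 3.1 (energy estimate)] -/
theorem linearisedNS_integral_norm_sq_le_sq_of_shear_of_crossStream (hν : 0 ≤ ν)
    (hu : Torus.IsSmoothSpaceTimeOn (Icc a b) u) (hudiv : ∀ t ∈ Icc a b, Torus.IsDivFree (u t))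
    (hw : Torus.IsSmoothSpaceTimeOn (Icc a b) w) (hq : Torus.IsSmoothSpaceTimeOn (Icc a b) q)
    (hwdiv : ∀ t ∈ Icc a b, Torus.IsDivFree (w t))
    (hlin : ∀ t ∈ Icc a b, ∀ x, Torus.timeDerivWithin (Icc a b) w t x + Torus.convect (u t) (w t) x +
      Torus.convect (w t) (u t) x = ν • Torus.laplacian (w t) x - Torus.gradient (q t) x)
    {k m : d} {c : ℝ → UnitAddTorus d → ℝ} {r : ℝ → ℝ}
    (h0 : ∀ t ∈ Icc a b, ∀ x, ∀ i, i ≠ k → Torus.partialDeriv i (u t) x = 0)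
    (hk : ∀ t ∈ Icc a b, ∀ x, Torus.partialDeriv k (u t) x = c t x • EuclideanSpace.single m (1 : ℝ))
    (hc : ∀ t ∈ Icc a b, ∀ x, |c t x| ≤ r t) (hr : Continuous r)
    {M : ℝ} (hM0 : 0 ≤ M) (hM : ∀ s ∈ Icc a b, ∫ x, (w s x k) ^ 2 ≤ M ^ 2)
    {t : ℝ} (ht : t ∈ Icc a b) :
    ∫ x, ‖w t x‖ ^ 2 ≤ (Real.sqrt (∫ x, ‖w a x‖ ^ 2) + M * ∫ s in a..t, r s) ^ 2 := by
  have hI0 : ∀ s, 0 ≤ ∫ x, ‖w s x‖ ^ 2 := fun s => integral_nonneg fun x => sq_nonneg _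
  rcases lt_or_ge a b with hab | hba
  · -- the energy `E` as an opaque function with its defining equation
    obtain ⟨E, hE_def⟩ : ∃ E : ℝ → ℝ, E = fun s => ∫ x, ‖w s x‖ ^ 2 := ⟨_, rfl⟩
    have hE0 : ∀ s, 0 ≤ E s := fun s => by
      rw [hE_def]
      exact hI0 s
    set E' : ℝ → ℝ := fun s => -(2 * ν * Torus.gradNormSq (w s)) -
      2 * ∫ x, ⟪Torus.convect (w s) (u s) x, w s x⟫_ℝ with hE'_def
    have hE : ∀ s ∈ Icc a b, HasDerivWithinAt E (E' s) (Icc a b) s := fun s hs => by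
      rw [hE_def]
      exact Torus.linearisedNS_hasDerivWithinAt_integral_norm_sq hu hudiv hw hq hwdiv hlin hab hs
    have hr0 : ∀ s ∈ Icc a b, 0 ≤ r s := fun s hs => (abs_nonneg _).trans (hc s hs 0)
    -- the weighted production bound: `E' ≤ r (λ M² + E / λ)` for every `λ > 0`
    have hE'le : ∀ s ∈ Icc a b, ∀ l : ℝ, 0 < l → E' s ≤ r s * (l * M ^ 2 + E s / l) := by
      intro s hs l hl
      have hws : Torus.IsSmooth (w s) := hw.isSmooth_slice hs
      have hus : Torus.IsSmooth (u s) := hu.isSmooth_slice hs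
      have hpw : ∀ x, 2 * |⟪Torus.convect (w s) (u s) x, w s x⟫_ℝ| ≤
          r s * (l * (w s x k) ^ 2 + ‖w s x‖ ^ 2 / l) := fun x =>
        (two_mul_abs_inner_convect_le_of_shear_weighted hus (h0 s hs x) (hk s hs x) hl).trans
          (mul_le_mul_of_nonneg_right (hc s hs x) (by positivity))
      have hsk : Torus.IsSmooth (fun x => (w s x k) ^ 2) := (hws.apply k).pow 2
      have hik : Integrable (fun x => (w s x k) ^ 2) volume := hsk.integrable
      have hin : Integrable (fun x => ‖w s x‖ ^ 2) volume := hws.norm_sq.integrable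
      have hI : 2 * |∫ x, ⟪Torus.convect (w s) (u s) x, w s x⟫_ℝ| ≤
          r s * (l * (∫ x, (w s x k) ^ 2) + E s / l) := by
        calc 2 * |∫ x, ⟪Torus.convect (w s) (u s) x, w s x⟫_ℝ|
            ≤ 2 * ∫ x, |⟪Torus.convect (w s) (u s) x, w s x⟫_ℝ| := by
              gcongr
              exact abs_integral_le_integral_abs
          _ = ∫ x, 2 * |⟪Torus.convect (w s) (u s) x, w s x⟫_ℝ| := (integral_const_mul _ _).symm
          _ ≤ ∫ x, r s * (l * (w s x k) ^ 2 + ‖w s x‖ ^ 2 / l) := by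
              refine integral_mono_of_nonneg (Eventually.of_forall fun x => by positivity)
                (((hik.const_mul l).add (hin.div_const l)).const_mul (r s)) (Eventually.of_forall hpw)
          _ = r s * (l * (∫ x, (w s x k) ^ 2) + E s / l) := by
              rw [integral_const_mul, integral_add (hik.const_mul l) (hin.div_const l), integral_const_mul,
                integral_div, hE_def]
      have hgrad : 0 ≤ 2 * ν * Torus.gradNormSq (w s) := mul_nonneg (by positivity) (Torus.gradNormSq_nonneg _)
      have habs := neg_abs_le (∫ x, ⟪Torus.convect (w s) (u s) x, w s x⟫_ℝ)
      have hmono : r s * (l * (∫ x, (w s x k) ^ 2) + E s / l) ≤ r s * (l * M ^ 2 + E s / l) :=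
        mul_le_mul_of_nonneg_left (by nlinarith [hM s hs, hl.le]) (hr0 s hs)
      show -(2 * ν * Torus.gradNormSq (w s)) - 2 * ∫ x, ⟪Torus.convect (w s) (u s) x, w s x⟫_ℝ ≤ _
      linarith
    -- the `ε`-regularised square root `G = (E + ε)^{1/2}` grows at most like `(M + ε) ∫ r`
    have key : ∀ ε : ℝ, 0 < ε →
        Real.sqrt (E t + ε) ≤ Real.sqrt (E a + ε) + (M + ε) * ∫ s in a..t, r s := by
      intro ε hε
      have hMε0 : 0 < M + ε := by linarith
      have hGpos : ∀ s, 0 < Real.sqrt (E s + ε) := fun s => Real.sqrt_pos.2 (by linarith [hE0 s])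
      have hGsq : ∀ s, Real.sqrt (E s + ε) ^ 2 = E s + ε := fun s => Real.sq_sqrt (by linarith [hE0 s])
      have hGd : ∀ s ∈ Icc a b, HasDerivWithinAt (fun y => Real.sqrt (E y + ε))
          (E' s / (2 * Real.sqrt (E s + ε))) (Icc a b) s := fun s hs =>
        ((hE s hs).add_const ε).sqrt (show 0 < E s + ε by linarith [hE0 s]).ne'
      have hGd_le : ∀ s ∈ Icc a b, E' s / (2 * Real.sqrt (E s + ε)) ≤ (M + ε) * r s := by
        intro s hs
        have hG := hGpos s
        rw [div_le_iff₀ (by positivity)]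
        have h1 := hE'le s hs (Real.sqrt (E s + ε) / (M + ε)) (div_pos hG hMε0)
        have hM2 : M ^ 2 ≤ (M + ε) ^ 2 := by gcongr; linarith
        have hEG : E s ≤ Real.sqrt (E s + ε) ^ 2 := by rw [hGsq]; linarith
        have h2 : Real.sqrt (E s + ε) / (M + ε) * M ^ 2 + E s / (Real.sqrt (E s + ε) / (M + ε)) ≤
            (M + ε) * (2 * Real.sqrt (E s + ε)) := by
          calc Real.sqrt (E s + ε) / (M + ε) * M ^ 2 + E s / (Real.sqrt (E s + ε) / (M + ε))
              ≤ Real.sqrt (E s + ε) / (M + ε) * (M + ε) ^ 2 +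
                  Real.sqrt (E s + ε) ^ 2 / (Real.sqrt (E s + ε) / (M + ε)) := by
                gcongr
            _ = (M + ε) * (2 * Real.sqrt (E s + ε)) := by
                field_simp
                ring
        calc E' s ≤ r s * (Real.sqrt (E s + ε) / (M + ε) * M ^ 2 + E s / (Real.sqrt (E s + ε) / (M + ε))) := h1
          _ ≤ r s * ((M + ε) * (2 * Real.sqrt (E s + ε))) := mul_le_mul_of_nonneg_left h2 (hr0 s hs)
          _ = (M + ε) * r s * (2 * Real.sqrt (E s + ε)) := by ring
      -- the comparison function `ψ = G − (M + ε) ∫ₐ r` is non-increasing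
      have hΦ : ∀ s, HasDerivAt (fun y => ∫ x in a..y, r x) (r s) s := fun s =>
        (hr.integral_hasStrictDerivAt a s).hasDerivAt
      set ψ : ℝ → ℝ := fun s => Real.sqrt (E s + ε) - (M + ε) * ∫ x in a..s, r x with hψ
      have hψd : ∀ s ∈ Icc a b, HasDerivWithinAt ψ
          (E' s / (2 * Real.sqrt (E s + ε)) - (M + ε) * r s) (Icc a b) s :=
        fun s hs => (hGd s hs).sub (((hΦ s).hasDerivWithinAt).const_mul (M + ε))
      have hψc : ContinuousOn ψ (Icc a b) := fun s hs => (hψd s hs).continuousWithinAt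
      have hψder : ∀ s ∈ Ico a b, HasDerivWithinAt ψ
          (E' s / (2 * Real.sqrt (E s + ε)) - (M + ε) * r s) (Ici s) s :=
        fun s hs => ((hψd s (Ico_subset_Icc_self hs)).mono (Icc_subset_Icc hs.1 le_rfl)).mono_of_mem_nhdsWithin
          (Icc_mem_nhdsGE hs.2)
      have hmain := Literature.Analysis.ODE.le_of_deriv_right_nonpos hψc hψder
        (fun s hs => by
          have := hGd_le s (Ico_subset_Icc_self hs)
          linarith) t ht
      have hmain' : Real.sqrt (E t + ε) - (M + ε) * (∫ x in a..t, r x) ≤ Real.sqrt (E a + ε) := by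
        simpa only [hψ, intervalIntegral.integral_same, mul_zero, sub_zero] using hmain
      linarith
    -- `ε → 0`
    have hlim : Real.sqrt (E t) ≤ Real.sqrt (E a) + M * ∫ s in a..t, r s := by
      set I : ℝ := ∫ s in a..t, r s with hI
      have hcont : Tendsto (fun ε : ℝ => Real.sqrt (E a + ε) + (M + ε) * I - Real.sqrt (E t + ε))
          (𝓝[>] 0) (𝓝 (Real.sqrt (E a + 0) + (M + 0) * I - Real.sqrt (E t + 0))) := by
        refine ((Continuous.tendsto ?_ 0).mono_left nhdsWithin_le_nhds)
        exact ((Real.continuous_sqrt.comp (continuous_const.add continuous_id)).add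
          ((continuous_const.add continuous_id).mul continuous_const)).sub
          (Real.continuous_sqrt.comp (continuous_const.add continuous_id))
      have hev : ∀ᶠ ε in 𝓝[>] (0 : ℝ),
          0 ≤ Real.sqrt (E a + ε) + (M + ε) * I - Real.sqrt (E t + ε) :=
        eventually_nhdsWithin_of_forall fun ε (hε : 0 < ε) => by linarith [key ε hε]
      have h := ge_of_tendsto hcont hev
      simp only [add_zero] at h
      linarith
    have hfin : E t ≤ (Real.sqrt (E a) + M * ∫ s in a..t, r s) ^ 2 :=
      calc E t = Real.sqrt (E t) ^ 2 := (Real.sq_sqrt (hE0 t)).symm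
        _ ≤ (Real.sqrt (E a) + M * ∫ s in a..t, r s) ^ 2 :=
            pow_le_pow_left₀ (Real.sqrt_nonneg _) hlim 2
    simpa only [hE_def] using hfin
  · have hta : t = a := le_antisymm (ht.2.trans hba) ht.1
    rw [hta, intervalIntegral.integral_same, mul_zero, add_zero, Real.sq_sqrt (hI0 a)]

end Energy

/-! ## §3 The V half-slot of the cascade -/

/-- **Cross-stream control of the energy on a V half-slot** `[a, b] = [tStart j + tHalf j, tStart (j+1)]`
(field jointly smooth there, `γ ≥ 0`, `δ j > 0`, `ν ≥ 0`; the vertical shear `(0, rateV j t · U_j(x₀))`,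
`|U_j′| ≤ 1`, strain `γ`): a smooth linearised solution `(w, q)` with `∫ (w(s) x)₀² ≤ M²` on the slot (`M ≥ 0`)
obeys `∫ ‖w(t)‖² ≤ ((∫ ‖w(a)‖²)^{1/2} + Mγ)²` on the slot (§2 + `integral_rateV_le`).
[cite: EllingsenPalm1975, eq. (5)–(7) (algebraic growth driven by the cross-stream velocity); ElgindiLissMattingly2025, §1 and Rmk. 1.4 (pulsed shear of strain α)] -/
theorem crossStream_energy_le_of_mem_V (P : CascadeParams) (hγ : 0 ≤ P.γ) {j : ℕ} (hδ : 0 < P.δ j)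
    {ν : ℝ} (hν : 0 ≤ ν)
    (hu : Torus.IsSmoothSpaceTimeOn (Icc (tStart j + tHalf j) (tStart (j + 1))) P.field)
    {w : ℝ → UnitAddTorus (Fin 2) → EuclideanSpace ℝ (Fin 2)} {q : ℝ → UnitAddTorus (Fin 2) → ℝ}
    (hw : Torus.IsSmoothSpaceTimeOn (Icc (tStart j + tHalf j) (tStart (j + 1))) w)
    (hq : Torus.IsSmoothSpaceTimeOn (Icc (tStart j + tHalf j) (tStart (j + 1))) q)
    (hwdiv : ∀ t ∈ Icc (tStart j + tHalf j) (tStart (j + 1)), Torus.IsDivFree (w t))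
    (hlin : ∀ t ∈ Icc (tStart j + tHalf j) (tStart (j + 1)), ∀ x,
      Torus.timeDerivWithin (Icc (tStart j + tHalf j) (tStart (j + 1))) w t x +
        Torus.convect (P.field t) (w t) x + Torus.convect (w t) (P.field t) x =
          ν • Torus.laplacian (w t) x - Torus.gradient (q t) x)
    {M : ℝ} (hM0 : 0 ≤ M)
    (hM : ∀ s ∈ Icc (tStart j + tHalf j) (tStart (j + 1)), ∫ x, (w s x 0) ^ 2 ≤ M ^ 2)
    {t : ℝ} (ht : t ∈ Icc (tStart j + tHalf j) (tStart (j + 1))) :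
    ∫ x, ‖w t x‖ ^ 2 ≤ (Real.sqrt (∫ x, ‖w (tStart j + tHalf j) x‖ ^ 2) + M * P.γ) ^ 2 := by
  have h1 := linearisedNS_integral_norm_sq_le_sq_of_shear_of_crossStream hν hu
    (fun s hs => P.isDivFree_field_of_mem_V hs) hw hq hwdiv hlin (k := (0 : Fin 2)) (m := 1)
    (c := fun s x => P.rateV j s * deriv (P.U j) (Torus.repr x 0)) (r := P.rateV j)
    (fun s hs x i hi => by
      obtain rfl : i = 1 := by omega
      exact (P.partialDeriv_field_of_mem_V hs x).1)
    (fun s hs x => (P.partialDeriv_field_of_mem_V hs x).2)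
    (fun s hs x => by
      rw [abs_mul, abs_of_nonneg (P.rateV_nonneg hγ j s)]
      calc P.rateV j s * |deriv (P.U j) (Torus.repr x 0)| ≤ P.rateV j s * 1 := by
            gcongr
            · exact P.rateV_nonneg hγ j s
            · exact P.abs_deriv_U_le_one hδ _
        _ = P.rateV j s := mul_one _)
    (P.continuous_rateV j) hM0 hM ht
  refine h1.trans ?_
  have hI0 : 0 ≤ ∫ s in (tStart j + tHalf j)..t, P.rateV j s :=
    intervalIntegral.integral_nonneg ht.1 fun s _ => P.rateV_nonneg hγ j s
  have hIγ := P.integral_rateV_le hγ ht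
  have hs0 : 0 ≤ Real.sqrt (∫ x, ‖w (tStart j + tHalf j) x‖ ^ 2) := Real.sqrt_nonneg _
  have hMI : M * (∫ s in (tStart j + tHalf j)..t, P.rateV j s) ≤ M * P.γ :=
    mul_le_mul_of_nonneg_left hIγ hM0
  exact pow_le_pow_left₀ (by positivity) (by linarith) 2

/-- **Cross-stream control of the energy on a V half-slot, relative form**: with `∫ (w(s) x)₀² ≤ C₀² ∫ ‖w(a)‖²`
on the slot (`C₀ ≥ 0`), `∫ ‖w(t)‖² ≤ (1 + C₀γ)² ∫ ‖w(a)‖²` there — amplification `(1 + C₀γ)²` instead of `e^{γ}`.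
[cite: EllingsenPalm1975, eq. (5)–(7) (algebraic growth driven by the cross-stream velocity); ElgindiLissMattingly2025, §1 and Rmk. 1.4 (pulsed shear of strain α)] -/
theorem crossStream_energy_le_of_mem_V' (P : CascadeParams) (hγ : 0 ≤ P.γ) {j : ℕ} (hδ : 0 < P.δ j)
    {ν : ℝ} (hν : 0 ≤ ν)
    (hu : Torus.IsSmoothSpaceTimeOn (Icc (tStart j + tHalf j) (tStart (j + 1))) P.field)
    {w : ℝ → UnitAddTorus (Fin 2) → EuclideanSpace ℝ (Fin 2)} {q : ℝ → UnitAddTorus (Fin 2) → ℝ}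
    (hw : Torus.IsSmoothSpaceTimeOn (Icc (tStart j + tHalf j) (tStart (j + 1))) w)
    (hq : Torus.IsSmoothSpaceTimeOn (Icc (tStart j + tHalf j) (tStart (j + 1))) q)
    (hwdiv : ∀ t ∈ Icc (tStart j + tHalf j) (tStart (j + 1)), Torus.IsDivFree (w t))
    (hlin : ∀ t ∈ Icc (tStart j + tHalf j) (tStart (j + 1)), ∀ x,
      Torus.timeDerivWithin (Icc (tStart j + tHalf j) (tStart (j + 1))) w t x +
        Torus.convect (P.field t) (w t) x + Torus.convect (w t) (P.field t) x =
          ν • Torus.laplacian (w t) x - Torus.gradient (q t) x)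
    {C₀ : ℝ} (hC0 : 0 ≤ C₀)
    (hM : ∀ s ∈ Icc (tStart j + tHalf j) (tStart (j + 1)),
      ∫ x, (w s x 0) ^ 2 ≤ C₀ ^ 2 * ∫ x, ‖w (tStart j + tHalf j) x‖ ^ 2)
    {t : ℝ} (ht : t ∈ Icc (tStart j + tHalf j) (tStart (j + 1))) :
    ∫ x, ‖w t x‖ ^ 2 ≤ (1 + C₀ * P.γ) ^ 2 * ∫ x, ‖w (tStart j + tHalf j) x‖ ^ 2 := by
  set E₀ : ℝ := ∫ x, ‖w (tStart j + tHalf j) x‖ ^ 2 with hE₀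
  have hE0 : 0 ≤ E₀ := integral_nonneg fun x => sq_nonneg _
  have hM' : ∀ s ∈ Icc (tStart j + tHalf j) (tStart (j + 1)),
      ∫ x, (w s x 0) ^ 2 ≤ (C₀ * Real.sqrt E₀) ^ 2 := fun s hs => by
    rw [mul_pow, Real.sq_sqrt hE0]
    exact hM s hs
  have h := crossStream_energy_le_of_mem_V P hγ hδ hν hu hw hq hwdiv hlin (by positivity) hM' ht
  calc ∫ x, ‖w t x‖ ^ 2 ≤ (Real.sqrt E₀ + C₀ * Real.sqrt E₀ * P.γ) ^ 2 := h
    _ = (1 + C₀ * P.γ) ^ 2 * Real.sqrt E₀ ^ 2 := by ring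
    _ = (1 + C₀ * P.γ) ^ 2 * E₀ := by rw [Real.sq_sqrt hE0]

/-! ## §4 Stub A verbatim from a cross-stream bound with constant `2` -/

/-- `1 + 2γ ≤ 3e^{σ⋆γ}` for every `γ ≥ 0` (`σ⋆ = 0.30982`): `e^x ≥ 1 + x + x²/2` (`x = σ⋆γ ≥ 0`) and the
quadratic `3(1 + x + x²/2) − 1 − 2γ = 2 − 1.07054γ + 0.1439826…γ²` has negative discriminant (minimum
`≈ 0.0101` at `γ ≈ 3.7176`).  So the algebraic amplification `(1 + 2γ)²` is swallowed by the route's cap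
`(3e^{σ⋆γ})²` at every strain. [folklore] -/
theorem one_add_two_mul_le_three_mul_exp {γ : ℝ} (hγ : 0 ≤ γ) :
    1 + 2 * γ ≤ 3 * Real.exp (sawSigmaStar * γ) := by
  have h := Real.quadratic_le_exp_of_nonneg (show 0 ≤ sawSigmaStar * γ by simp only [sawSigmaStar]; positivity)
  have hq : 1 + 2 * γ ≤ 3 * (1 + sawSigmaStar * γ + (sawSigmaStar * γ) ^ 2 / 2) := by
    simp only [sawSigmaStar]
    nlinarith [sq_nonneg (γ - 3.7176)]
  linarith

/-- The route's parameter point has positive rounding widths: `δ j = (1/4)/2^j > 0`. -/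
theorem boxδ_pos (γ : ℝ) (ρN : ℕ) (j : ℕ) : 0 < (⟨γ, 1 / 4, 2, 1, ρN⟩ : CascadeParams).δ j :=
  CascadeParams.δ_pos _ (by norm_num) (by norm_num) j

/-- **`stub_injectionPhase` ⇐ the CROSS-STREAM bound with constant `2` for single harmonics, `γ ∈ (5.77, 8]`.**
If for every `γ ∈ (5.77, 8]`, `ρN ∈ {2,…,7}` there is `ν₀ > 0` such that for `ν ∈ (0, ν₀]`, every `j₀`, every odd
multiple `l = (2n+1)N_{j₀} ≥ 1`, every `z ∈ ℂ²` with `z₁ = 0`, every classical linearised solution `(W, Q)` on the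
V half-slot `[a, b]` of phase `j₀` with `W(a) = Re (e_{l e₁} z)` has `∫ (W(t) x)₀² ≤ 2² ‖W(a)‖²` on the slot, then the
registered stub A of the line `phase-cocycle` holds VERBATIM (`crossStream_energy_le_of_mem_V'`: amplification
`(1 + 2γ)²`; `one_add_two_mul_le_three_mul_exp`: `≤ (3e^{σ⋆γ})²`; then `injectionPhase_of_harmonics`, p793897). -/
theorem injectionPhase_of_crossStream
    (hX : ∀ γ ∈ Ioc (5.77 : ℝ) 8, ∀ ρN ∈ Finset.Icc 2 7, ∃ ν₀ : ℝ, 0 < ν₀ ∧ ∀ ν ∈ Ioc 0 ν₀, ∀ (j₀ : ℕ)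
      (l : ℕ), 1 ≤ l → (∃ n : ℤ, (l : ℤ) = (2 * n + 1) * (((⟨γ, 1 / 4, 2, 1, ρN⟩ : CascadeParams).N j₀ : ℕ) : ℤ)) →
      ∀ z : EuclideanSpace ℂ (Fin 2), z 1 = 0 →
      ∀ (W : ℝ → UnitAddTorus (Fin 2) → EuclideanSpace ℝ (Fin 2)) (Q : ℝ → UnitAddTorus (Fin 2) → ℝ),
      Torus.IsSmoothSpaceTimeOn (Icc (CascadeParams.tStart j₀ + CascadeParams.tHalf j₀)
        (CascadeParams.tStart (j₀ + 1))) W →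
      Torus.IsSmoothSpaceTimeOn (Icc (CascadeParams.tStart j₀ + CascadeParams.tHalf j₀)
        (CascadeParams.tStart (j₀ + 1))) Q →
      (∀ s ∈ Icc (CascadeParams.tStart j₀ + CascadeParams.tHalf j₀) (CascadeParams.tStart (j₀ + 1)),
        Torus.IsDivFree (W s)) →
      (∀ s ∈ Icc (CascadeParams.tStart j₀ + CascadeParams.tHalf j₀) (CascadeParams.tStart (j₀ + 1)), ∀ x,
        Torus.timeDerivWithin (Icc (CascadeParams.tStart j₀ + CascadeParams.tHalf j₀)
            (CascadeParams.tStart (j₀ + 1))) W s x +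
          Torus.convect ((⟨γ, 1 / 4, 2, 1, ρN⟩ : CascadeParams).field s) (W s) x +
          Torus.convect (W s) ((⟨γ, 1 / 4, 2, 1, ρN⟩ : CascadeParams).field s) x =
          ν • Torus.laplacian (W s) x - Torus.gradient (Q s) x) →
      W (CascadeParams.tStart j₀ + CascadeParams.tHalf j₀) =
        Torus.realTrigPoly {Pi.single 1 (l : ℤ)} (fun _ => z) →
      ∀ t ∈ Icc (CascadeParams.tStart j₀ + CascadeParams.tHalf j₀) (CascadeParams.tStart (j₀ + 1)),
        ∫ x, (W t x 0) ^ 2 ≤ 2 ^ 2 *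
          Torus.vectorL2Sq (W (CascadeParams.tStart j₀ + CascadeParams.tHalf j₀))) :
    ∀ γ ∈ Icc (4 : ℝ) 8, ∀ ρN ∈ Finset.Icc 2 7, ∃ ν₀ : ℝ, 0 < ν₀ ∧ ∀ ν ∈ Ioc 0 ν₀, ∀ (j₀ : ℕ) (hz : Bool)
      (w₀ : UnitAddTorus (Fin 2) → EuclideanSpace ℝ (Fin 2))
      (w : ℝ → UnitAddTorus (Fin 2) → EuclideanSpace ℝ (Fin 2)) (q : ℝ → UnitAddTorus (Fin 2) → ℝ),
      ShearCombDatum ((⟨γ, 1 / 4, 2, 1, ρN⟩ : CascadeParams).N j₀) hz w₀ →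
      Torus.IsSmoothSpaceTimeOn (Icc (CascadeParams.tInject j₀ hz) (CascadeParams.tStart (j₀ + 1))) w →
      Torus.IsSmoothSpaceTimeOn (Icc (CascadeParams.tInject j₀ hz) (CascadeParams.tStart (j₀ + 1))) q →
      (∀ t ∈ Icc (CascadeParams.tInject j₀ hz) (CascadeParams.tStart (j₀ + 1)), Torus.IsDivFree (w t)) →
      (∀ t ∈ Icc (CascadeParams.tInject j₀ hz) (CascadeParams.tStart (j₀ + 1)), ∀ x,
        Torus.timeDerivWithin (Icc (CascadeParams.tInject j₀ hz) (CascadeParams.tStart (j₀ + 1))) w t x +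
          Torus.convect ((⟨γ, 1 / 4, 2, 1, ρN⟩ : CascadeParams).field t) (w t) x +
          Torus.convect (w t) ((⟨γ, 1 / 4, 2, 1, ρN⟩ : CascadeParams).field t) x =
          ν • Torus.laplacian (w t) x - Torus.gradient (q t) x) →
      w (CascadeParams.tInject j₀ hz) = w₀ →
      ∀ t ∈ Icc (CascadeParams.tInject j₀ hz) (CascadeParams.tStart (j₀ + 1)),
        Torus.vectorL2Sq (w t) ≤ (3 * Real.exp (sawSigmaStar * γ)) ^ 2 * Torus.vectorL2Sq w₀ := by
  refine injectionPhase_of_harmonics fun γ hγ ρN hρ => ?_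
  obtain ⟨ν₀, hν₀, H⟩ := hX γ hγ ρN hρ
  refine ⟨ν₀, hν₀, fun ν hν j₀ l hl hodd z hz W Q hW hQ hdiv hlin hWa t ht => ?_⟩
  set P : CascadeParams := ⟨γ, 1 / 4, 2, 1, ρN⟩ with hP
  have hγ0 : 0 ≤ P.γ := by
    show 0 ≤ γ
    linarith [hγ.1]
  have hu : Torus.IsSmoothSpaceTimeOn (Icc (tStart j₀ + tHalf j₀) (tStart (j₀ + 1))) P.field :=
    (cascadeFieldSmooth P (by norm_num [hP]) (by norm_num [hP])).mono (Icc_V_subset_Ico j₀)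
  have hM : ∀ s ∈ Icc (tStart j₀ + tHalf j₀) (tStart (j₀ + 1)),
      ∫ x, (W s x 0) ^ 2 ≤ 2 ^ 2 * ∫ x, ‖W (tStart j₀ + tHalf j₀) x‖ ^ 2 :=
    fun s hs => H ν hν j₀ l hl hodd z hz W Q hW hQ hdiv hlin hWa s hs
  have h := crossStream_energy_le_of_mem_V' P hγ0 (boxδ_pos γ ρN j₀) hν.1.le hu hW hQ hdiv hlin
    (by norm_num : (0 : ℝ) ≤ 2) hM ht
  have hcap : (1 + 2 * P.γ) ^ 2 ≤ (3 * Real.exp (sawSigmaStar * γ)) ^ 2 :=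
    pow_le_pow_left₀ (by positivity) (one_add_two_mul_le_three_mul_exp hγ0) 2
  have e1 : Torus.vectorL2Sq (W t) = ∫ x, ‖W t x‖ ^ 2 := rfl
  have e2 : Torus.vectorL2Sq (W (tStart j₀ + tHalf j₀)) = ∫ x, ‖W (tStart j₀ + tHalf j₀) x‖ ^ 2 := rfl
  rw [e1, e2]
  exact h.trans (mul_le_mul_of_nonneg_right hcap (integral_nonneg fun x => sq_nonneg _))

end Summit.AnomalousDissipation.AnomalousDissipation.Theorems.SawtoothPulseCascade.K2Classical

end
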